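import Summits.ResolutionOfSingularities.ResolutionOfSingularities.Theorems.FrobeniusClosingPatchingRelPerfectDepthWeightTwoBPieceStepOut
import HarnessLib

/-!
# Crux `PatchingRelPerfect` (stmt-ResolutionOfSingularities-16161), chain W5.2 — F6 STAGE 2, target T6-E2 `SeparationBoundary₃`,
# PHASE A «CJS ⇒ weight-one sequence»: the TRANSPORT STATE, the CENTRE DATA of a piece, and the INPUT clauses of one step

[OURS · L1 W5.2 · TargetsF6 T6-E2 Phase A] Fact-free; NOT statements of the manuscript under review (Hironaka 2017); format-free
(no `IsSepSeq` names: the by-name `cons` is assembled in the loop module).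

THE PHASE.  On the regular threefold `E` the stage-2 datum is a NON-REDUCED locally principal ideal `𝔟` (the host trace `𝓗|_E`);
Phase A runs the Cossart–Jannsen–Saito sequence (F-32bR, `B = ∅`) over the REDUCED zero set `V(𝔟)_red` and transports it into the
weight-ONE format of TargetsF6 §4 (`IsSepSeq`), exactly as T5-E's `WeightTwoB.cjs_transport` transported it into `IsWeightedSeqJR 2`
— with two differences: the host `H` (the iterated strict transform of `𝔟` itself) is NOT reduced and carries no (J#) invariant, and
the weight is ALWAYS one.  The state carried on the current scheme `W` is `StateA 𝔟 H ℬ 𝒟`: `𝔟 = H · monomialIdeal ℬ` with `H` an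
effective Cartier divisor, the born traces `boundaryOf ℬ` snc with irreducible supports, none inside `Supp H`, every E-multiplicity
`≥ 1` (`pos`: every born trace is a COMPONENT of `V(𝔟)`), and the N-exponent list `𝒟` of the format living on the same sheaves
(`boundaryOf 𝒟 = boundaryOf ℬ`).  A piece `Z` of a CJS centre brings `CentreA 𝔟 H ℬ Z`: irreducible, `V(𝓘(Z))` regular,
`Z ⊆ Supp H`, the born traces snc with `𝓘(Z)`, and ORD2 «`ord_z 𝔟 ≥ 2` at every `z ∈ Z`» — read once from CJS's per-step clause
«singular point of `X_j` OR on `B_j`» (`ord2_of_bsing`: at a point where `V(H)_red` is singular a generator of `H_z` lies in `𝔪_z²`;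
at a point of a born trace the trace factor and the host factor each contribute order `≥ 1`).  Consequences (§3): the single-piece
datum `WeightTwoB.PieceIn 𝔟 H ℬ [] Z η` of T5-E with `pieceWeight = 2` (so its permissibility field is vacuous and all its
format-free lemmas apply), `𝔟 ≤ 𝓘(Z)`, the boundary clauses of the weight-one step for `𝒟`, the JOINT clause VACUOUS
(`¬ ord_z 𝔟 ≤ 1` on `Z`), and the exponent inequality `2 ≤ m + w` (`m = ord_η H`, `w = weightAt ℬ η`) making the new trace a
component again.  The output side of the step (new state, supports, transport of the centre data of disjoint pieces) is the
companion module `…DepthSepCJSPieceStep`.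

AI-written; AI review is weaker than expert review.

## References
* V. Cossart, U. Jannsen, S. Saito, *Desingularization: Invariants and Strategy*, LNM 2270 (2020), Thm. 1.4, Def. 4.1, (6.2),
  Thm. 6.9 (a), Def. 6.1 (2). [CossartJannsenSaito2020]
* E. Bierstone, D. Grigoriev, P. Milman, J. Włodarczyk, arXiv:1206.3090, Def. 3.1.3, §4 Step 2. [BierstoneGrigorievMilmanWlodarczyk2011]
* J. Kollár, *Lectures on Resolution of Singularities* (2007), 3.30.2, (3.111) Steps 1–3. [Kollar2007]
-/

-- `Summit.<Summit>.<Sub>.Theorems` with `Sub = Summit` (single-conjunct summit, D-0017)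
set_option linter.dupNamespace false

noncomputable section

open CategoryTheory CategoryTheory.Limits AlgebraicGeometry TopologicalSpace IsLocalRing
open Literature.AlgebraicGeometry.Resolution Scheme.IdealSheafData

namespace Summit.ResolutionOfSingularities.ResolutionOfSingularities.Theorems

universe u

namespace SepCJS

open DepthSNC WeightTwoB
open Literature.AlgebraicGeometry.Hironaka2017.S16Proof
open Literature.AlgebraicGeometry.Hironaka2017.MonomialPart Literature.AlgebraicGeometry.Hironaka2017.MonomialComponent

variable {W : Scheme.{u}}

/-! ## §1 The transport state and the centre data -/

/-- [OURS · L1 W5.2] **The global transport state of Phase A** on the current (regular) scheme (see the module docstring):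
`𝔟 = H · monomialIdeal ℬ`, `H` an effective Cartier divisor (NOT assumed reduced), the born traces snc, irreducible, none inside
`Supp H`, all with multiplicity `≥ 1`, and the format's N-exponent list on the same sheaves.
[cite: BierstoneGrigorievMilmanWlodarczyk2011, Def. 3.1.3] [cite: Kollar2007, 3.30.2] -/
structure StateA [IsLocallyNoetherian W] (𝔟 H : W.IdealSheafData) (ℬ 𝒟 : List (W.IdealSheafData × ℕ)) : Prop where
  /-- the ambient scheme is regular -/
  regW : Scheme.IsRegular W
  /-- the factorisation host · trace monomial -/
  fac : 𝔟 = H * monomialIdeal ℬ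
  /-- the host is an effective Cartier divisor -/
  hostCartier : IsEffectiveCartier H
  /-- the born traces have simple normal crossings -/
  sncB : HasSNC (boundaryOf ℬ)
  /-- the born traces have irreducible supports -/
  irred : ∀ p ∈ ℬ, IsIrreducible (p.1.support : Set W)
  /-- no born trace has its support inside the host -/
  free : ∀ p ∈ ℬ, ¬ ((p.1.support : Set W) ⊆ H.support)
  /-- every born trace is a component of `V(𝔟)`: its multiplicity is positive -/
  pos : ∀ p ∈ ℬ, 1 ≤ p.2
  /-- the format's N-exponent list lives on exactly the born traces -/
  bd : boundaryOf 𝒟 = boundaryOf ℬ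

/-- [OURS · L1 W5.2] **The centre data of one piece** `Z` of a CJS centre in Phase A (see the module docstring); `ord2` is the
E-side reading of CJS's «every point of the centre is a singular point of `X_j` or lies on `B_j`».
[cite: CossartJannsenSaito2020, Thm. 6.9 (a), Def. 6.1 (2), Def. 4.1] -/
structure CentreA [IsLocallyNoetherian W] (𝔟 H : W.IdealSheafData) (ℬ : List (W.IdealSheafData × ℕ)) (Z : Closeds W) :
    Prop where
  /-- the piece is irreducible -/
  irred : IsIrreducible (Z : Set W)
  /-- the piece is a regular closed subscheme -/
  regZ : Scheme.IsRegular (vanishingIdeal Z).subscheme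
  /-- the piece lies on the host -/
  subZ : (Z : Set W) ⊆ H.support
  /-- the born traces have simple normal crossings with the piece -/
  sncZ : HasSNCWith (boundaryOf ℬ) (vanishingIdeal Z)
  /-- ORD2: `𝔟` has order at least two at every point of the piece -/
  ord2 : ∀ z ∈ (Z : Set W), (2 : ℕ∞) ≤ idealOrder 𝔟 z

namespace CentreA

variable [IsLocallyNoetherian W] {𝔟 H : W.IdealSheafData} {ℬ : List (W.IdealSheafData × ℕ)} {Z : Closeds W}

/-- An irreducible closed piece has a generic point. [folklore] -/
theorem exists_isGenericPoint (Γ : CentreA 𝔟 H ℬ Z) : ∃ η : W, IsGenericPoint η (Z : Set W) :=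
  QuasiSober.sober Γ.irred Z.isClosed

/-- The max-weight of the piece is two (ORD2). [folklore] -/
theorem pieceWeight_eq_two (Γ : CentreA 𝔟 H ℬ Z) : pieceWeight 𝔟 (Z : Set W) = 2 :=
  (pieceWeight_eq_two_iff 𝔟 _).mpr Γ.ord2

end CentreA

namespace StateA

variable [IsLocallyNoetherian W] {𝔟 H : W.IdealSheafData} {ℬ 𝒟 : List (W.IdealSheafData × ℕ)} (S : StateA 𝔟 H ℬ 𝒟)
include S

/-- **State + centre data + generic point = T5-E's single-piece datum with the EMPTY N-list** (its (J#) field and its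
permissibility field are then vacuous, the latter because the max-weight is two). [folklore] -/
theorem pieceIn {Z : Closeds W} (Γ : CentreA 𝔟 H ℬ Z) {η : W} (hη : IsGenericPoint η (Z : Set W)) :
    PieceIn 𝔟 H ℬ [] Z η where
  regW := S.regW
  fac := S.fac
  hostCartier := S.hostCartier
  sncB := S.sncB
  sub𝒟 := fun p hp => by simp at hp
  joint := fun x _ h => by obtain ⟨p, hp, -⟩ := h; simp at hp
  gen := hη
  regZ := Γ.regZ
  subZ := Γ.subZ
  sncZ := Γ.sncZ
  perm := fun h1 => absurd (Γ.pieceWeight_eq_two.symm.trans h1) (by decide)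

/-- Ideal form of «no born trace inside the host». [folklore] -/
theorem not_host_le (p : W.IdealSheafData × ℕ) (hp : p ∈ ℬ) : ¬ H ≤ p.1 := fun h =>
  S.free p hp (support_antitone h)

/-- The support of a born trace is not contained in a piece `Z ⊆ Supp H`. [folklore] -/
theorem not_support_subset_of_subset {p : W.IdealSheafData × ℕ} (hp : p ∈ ℬ) {Z : Set W} (hZ : Z ⊆ H.support) :
    ¬ ((p.1.support : Set W) ⊆ Z) := fun h => S.free p hp (h.trans hZ)

/-- `𝔟 ≤ H`. [folklore] -/
theorem le_host : 𝔟 ≤ H := by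
  rw [S.fac]
  exact Scheme.IdealSheafData.le_def.mpr fun U => by
    rw [Scheme.IdealSheafData.ideal_mul, Pi.mul_apply]; exact Ideal.mul_le_right

omit [IsLocallyNoetherian W] S in
/-- `monomialIdeal ℬ ≤ B ^ e` for a member `(B, e)`. [folklore] -/
theorem monomialIdeal_le_pow_of_mem {p : W.IdealSheafData × ℕ} (hp : p ∈ ℬ) : monomialIdeal ℬ ≤ p.1 ^ p.2 := by
  induction ℬ with
  | nil => simp at hp
  | cons q ℬ ih =>
    rw [monomialIdeal_cons]
    rcases List.mem_cons.mp hp with rfl | hp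
    · exact Scheme.IdealSheafData.le_def.mpr fun U => by
        rw [Scheme.IdealSheafData.ideal_mul, Pi.mul_apply]; exact Ideal.mul_le_right
    · refine le_trans ?_ (ih hp)
      exact Scheme.IdealSheafData.le_def.mpr fun U => by
        rw [Scheme.IdealSheafData.ideal_mul, Pi.mul_apply]; exact Ideal.mul_le_left

/-- At a point of a born trace the trace monomial lies in the maximal ideal (multiplicity `≥ 1`). [folklore] -/
theorem stalkIdeal_monomialIdeal_le {p : W.IdealSheafData × ℕ} (hp : p ∈ ℬ) {z : W} (hzp : z ∈ p.1.support) :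
    stalkIdeal (monomialIdeal ℬ) z ≤ maximalIdeal (W.presheaf.stalk z) := by
  refine (stalkIdeal_mono (monomialIdeal_le_pow_of_mem hp) z).trans ?_
  rw [stalkIdeal_pow]
  exact (Ideal.pow_le_self (by have := S.pos p hp; omega)).trans ((mem_support_iff_stalkIdeal_le p.1 z).mp hzp)

end StateA

/-! ## §2 The initial state and ORD2 from CJS's per-step clause -/

/-- **The initial state** `(𝔟, H = 𝔟, [], [])` for a non-zero locally principal `𝔟` on a regular scheme.
[cite: CossartJannsenSaito2020, Thm. 1.4] -/
theorem StateA.init [IsIntegral W] [IsLocallyNoetherian W] (hW : Scheme.IsRegular W) {𝔟 : W.IdealSheafData} (h𝔟 : 𝔟 ≠ ⊥)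
    (hlp : IsLocallyPrincipal 𝔟) : StateA 𝔟 𝔟 [] [] where
  regW := hW
  fac := by rw [WeightTwoB.monomialIdeal_nil, Scheme.IdealSheafData.mul_top]
  hostCartier := hlp.isEffectiveCartier_of_ne_bot h𝔟
  sncB := by
    simpa [boundaryOf] using hasSNCWith_nil_of_isRegular hW (isRegular_subscheme_top (X := W))
  irred := fun p hp => by simp at hp
  free := fun p hp => by simp at hp
  pos := fun p hp => by simp at hp
  bd := rfl

/-- **An effective Cartier divisor of order one at a point of a regular scheme has a regular reduced zero-scheme there**: if
`H_z = (h)` with `h ∉ 𝔪_z²` then `𝒪_z ⧸ √H_z` is a regular local ring (`h` is a regular parameter, `(h)` is prime, `√(h) = (h)`).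
[cite: Kollar2007, 3.30.2] -/
theorem isRegularLocalRing_quotient_radical_of_idealOrder_le_one [IsLocallyNoetherian W] {H : W.IdealSheafData}
    (hH : IsEffectiveCartier H) {z : W} [IsRegularLocalRing (W.presheaf.stalk z)] (hz : z ∈ H.support)
    (hord : idealOrder H z ≤ 1) :
    IsRegularLocalRing ((W.presheaf.stalk z) ⧸ stalkIdeal (vanishingIdeal H.support) z) := by
  obtain ⟨h, hh0, hh⟩ := hH.exists_stalkIdeal_eq_span z
  have hhm : h ∈ maximalIdeal (W.presheaf.stalk z) := by
    have hle := (mem_support_iff_stalkIdeal_le H z).mp hz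
    rw [hh] at hle
    exact hle (Ideal.mem_span_singleton_self h)
  have hh2 : h ∉ maximalIdeal (W.presheaf.stalk z) ^ 2 := by
    intro hmem
    have h2 : ((2 : ℕ) : ℕ∞) ≤ idealOrder H z := by
      rw [le_idealOrder_iff, hh, Ideal.span_singleton_le_iff_mem]; exact hmem
    have : (2 : ℕ∞) ≤ 1 := (by exact_mod_cast h2 : (2 : ℕ∞) ≤ idealOrder H z).trans hord
    exact absurd this (by decide)
  -- `(h)` is the ideal of a regular quotient, hence prime, hence radical
  haveI hreg : IsRegularLocalRing ((W.presheaf.stalk z) ⧸ Ideal.span {h}) :=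
    (IsRegularLocalRing.quotient_span_singleton hhm hh2).1
  haveI : IsDomain ((W.presheaf.stalk z) ⧸ Ideal.span {h}) := @isDomain_of_isRegularLocalRing _ _ hreg
  have hprime : (Ideal.span {h} : Ideal (W.presheaf.stalk z)).IsPrime :=
    (Ideal.Quotient.isDomain_iff_prime _).mp inferInstance
  have hrad : stalkIdeal (vanishingIdeal H.support) z = Ideal.span {h} := by
    rw [Scheme.IdealSheafData.vanishingIdeal_support, stalkIdeal_radical, hh]
    exact hprime.radical
  rw [hrad]
  exact hreg

/-- **ORD2 from CJS's per-step clause.** In a state, at a point `z ∈ Supp H` which is a SINGULAR point of the reduced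
zero-scheme of the host OR lies on a born trace, `ord_z 𝔟 ≥ 2`: in the first case `ord_z H ≥ 2` by the previous lemma; in the
second `𝔟_z = H_z · M_z ⊆ 𝔪_z · 𝔪_z` (the trace has multiplicity `≥ 1`). [cite: CossartJannsenSaito2020, Thm. 6.9 (a), Def. 6.1 (2)] -/
theorem StateA.ord2_of_bsing [IsLocallyNoetherian W] {𝔟 H : W.IdealSheafData} {ℬ 𝒟 : List (W.IdealSheafData × ℕ)}
    (S : StateA 𝔟 H ℬ 𝒟) {z : W} (hz : z ∈ H.support)
    (h : ¬ IsRegularLocalRing ((W.presheaf.stalk z) ⧸ stalkIdeal (vanishingIdeal H.support) z) ∨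
      ∃ p ∈ ℬ, z ∈ p.1.support) :
    (2 : ℕ∞) ≤ idealOrder 𝔟 z := by
  haveI := S.regW z
  rcases h with h | ⟨p, hp, hzp⟩
  · -- singular point of `V(H)_red`: `ord_z H ≥ 2`, and `𝔟 ≤ H`
    have hH : (2 : ℕ∞) ≤ idealOrder H z := by
      by_contra hlt
      rw [not_le] at hlt
      have h1 : idealOrder H z ≤ 1 :=
        (ENat.lt_add_one_iff ENat.one_ne_top).mp (by simpa only [show (2 : ℕ∞) = 1 + 1 from rfl] using hlt)
      exact h (isRegularLocalRing_quotient_radical_of_idealOrder_le_one S.hostCartier hz h1)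
    have hH' := (le_idealOrder_iff H z 2).mp (by exact_mod_cast hH)
    exact_mod_cast (le_idealOrder_iff 𝔟 z 2).mpr ((stalkIdeal_mono S.le_host z).trans hH')
  · -- on a born trace: two factors in `𝔪_z`
    have h2 : stalkIdeal 𝔟 z ≤ maximalIdeal (W.presheaf.stalk z) ^ 2 := by
      rw [S.fac, stalkIdeal_mul, pow_two]
      exact Ideal.mul_mono ((mem_support_iff_stalkIdeal_le H z).mp hz) (S.stalkIdeal_monomialIdeal_le hp hzp)
    exact_mod_cast (le_idealOrder_iff 𝔟 z 2).mpr h2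

/-! ## §3 The input clauses of the weight-one step at a piece -/

namespace StateA

variable [IsLocallyNoetherian W] {𝔟 H : W.IdealSheafData} {ℬ 𝒟 : List (W.IdealSheafData × ℕ)} (S : StateA 𝔟 H ℬ 𝒟)
  {Z : Closeds W} (Γ : CentreA 𝔟 H ℬ Z) {η : W} (hη : IsGenericPoint η (Z : Set W))
include S Γ

/-- PERMISSIBILITY WITH WEIGHT ONE: `𝔟 ≤ 𝓘(Z)`. [cite: BierstoneGrigorievMilmanWlodarczyk2011, Lemma 3.2.1 (1)] -/
theorem le_centre : 𝔟 ≤ vanishingIdeal Z :=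
  Scheme.IdealSheafData.le_support_iff_le_vanishingIdeal.mp fun _ hx => support_antitone S.le_host (Γ.subZ hx)

/-- `𝔟 ≤ 𝓘(Z) ^ 1`. [folklore] -/
theorem le_centre_pow_one : 𝔟 ≤ vanishingIdeal Z ^ 1 := by
  rw [pow_one]; exact S.le_centre Γ

/-- The format's boundary has simple normal crossings with the piece. [cite: CossartJannsenSaito2020, Def. 4.1] -/
theorem sncZ𝒟 : HasSNCWith (boundaryOf 𝒟) (vanishingIdeal Z) := by
  rw [S.bd]; exact Γ.sncZ

omit [IsLocallyNoetherian W] S Γ in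
include hη in
/-- UNIFORM INCIDENCE of the format's boundary with the piece. [cite: Kollar2007, (3.111) Step 1] -/
theorem uniformPieces𝒟 : UniformPieces 𝒟 (vanishingIdeal Z) [(vanishingIdeal Z).support] :=
  uniformPieces_single_of_isGenericPoint 𝒟 hη

omit S in
/-- **The JOINT clause is VACUOUS in Phase A**: at every point of the piece `𝔟_z ⊆ 𝔪_z²`, so the order-one guard never
fires. [cite: CossartJannsenSaito2020, Thm. 6.9 (a)] -/
theorem stalkIdeal_le_sq {z : W} (hz : z ∈ ((vanishingIdeal Z).support : Set W)) :
    stalkIdeal 𝔟 z ≤ maximalIdeal (W.presheaf.stalk z) ^ 2 := by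
  rw [Scheme.IdealSheafData.coe_support_vanishingIdeal] at hz
  exact (le_idealOrder_iff 𝔟 z 2).mp (by exact_mod_cast Γ.ord2 z hz)

include hη in
/-- **The exponent inequality `2 ≤ m + w`** at the generic point (`m = ord_η H ≥ 1`, `w = weightAt ℬ η`): the new trace
`(C𝒪, m + w − 1)` of the weight-one step has multiplicity `≥ 1`. [cite: BierstoneGrigorievMilmanWlodarczyk2011, §4 Step 2a] -/
theorem two_le_add_weightAt {m : ℕ} (hm : idealOrder H η = m) (hm1 : 1 ≤ m) : 2 ≤ m + weightAt ℬ η := by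
  refine le_add_weightAt_of_le_two S.sncB le_rfl hm1 hm ?_
  rw [← S.fac]
  exact_mod_cast Γ.ord2 η hη.mem

include hη in
/-- The same inequality in the `divisorsOver` currency of the format. [folklore] -/
theorem one_le_newExp {m : ℕ} (hm : idealOrder H η = m) (hm1 : 1 ≤ m) :
    1 ≤ m + weightOf ℬ (divisorsOver ℬ (vanishingIdeal Z) (vanishingIdeal Z).support) - 1 := by
  rw [weightOf_divisorsOver_single_eq_weightAt ℬ hη]
  have := S.two_le_add_weightAt Γ hη hm hm1
  omega

end StateA

end SepCJS

end Summit.ResolutionOfSingularities.ResolutionOfSingularities.Theorems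

end
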